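import Summits.Ventures.PercRepro.MSStrictKleitman
import Mathlib.Data.Finset.Max

/-!
# Lemma X — an extremal statement about up-sets of one cube

Dossier proofs/MINE1-theoremS.md, Addendum 57 suppl. 3–4. **Lemma X** (`lemmaX_lost`, `lemmaX`):
let `U` be an up-set of `Finset α`, `U₀ ⊆ U` an up-set with `U ∖ U₀ ≠ ∅`,
`D := {univ ∖ y : y ∈ U₀}` (a lower set), and `T ⊊ U₀`. Then the members of `D` lying below some
member of `(U ∖ U₀) ∪ T` number at least `|T| + 1`; equivalently the LOST members of `D` (those all
of whose `U`-supersets lie in `R := U₀ ∖ T`) number at most `|R| − 1`.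
In the lane, Lemma X is what makes the fibre excess of a non-full row of a shape-A excess-one
configuration positive, hence (ROW-a): all partnerless `r`-free members lie in one row
(Addendum 57 suppl. 4).

Proof: `Lost` is an up-set of `D` not containing `∅`; with `A := ↑Lost` (an up-set of
`Finset α`), `D ∩ A = Lost` and `U₀ ∩ A ⊆ R`; complementation maps `U₀ ∩ A` onto
`D ∩ (univ − A)`; Harris–Kleitman (two lower sets, Mathlib `IsLowerSet.le_card_inter_finset`)
gives `|D||A| ≤ 2^|α| |D ∩ (univ − A)|`, and the STRICT Harris–Kleitman
(`card_inter_mul_lt_of_depends`, MSStrictKleitman.lean: the lower set `D` and the upper set `A`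
depend on a common coordinate `e ∈ z ∖ y₁`, `z` a lost set of minimal cardinality, `y₁ ∈ U ∖ U₀`)
gives `2^|α| |D ∩ A| < |D||A|`; so `|Lost| < |U₀ ∩ A| ≤ |R|`.
-/

namespace PercRepro.MSTight

open Finset

variable {α : Type*} [DecidableEq α] [Fintype α]

section Complements

/-- The family of complements (inside `univ`). -/
def cofam (G : Finset (Finset α)) : Finset (Finset α) := G.image fun s => univ \ s

/-- Membership in `cofam`. -/
theorem mem_cofam {G : Finset (Finset α)} {w : Finset α} :
    w ∈ cofam G ↔ ∃ y ∈ G, univ \ y = w := by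
  simp [cofam]

/-- `univ \ ·` is injective. -/
theorem univ_sdiff_injective : Function.Injective (fun s : Finset α => univ \ s) := by
  intro s t h
  have h' : univ \ s = univ \ t := h
  rw [← Finset.sdiff_sdiff_eq_self (subset_univ s), h', Finset.sdiff_sdiff_eq_self (subset_univ t)]

/-- `|cofam G| = |G|`. -/
theorem card_cofam (G : Finset (Finset α)) : (cofam G).card = G.card :=
  card_image_of_injective _ univ_sdiff_injective

/-- The complements of an upper set form a lower set. -/
theorem isLowerSet_cofam {G : Finset (Finset α)} (h : IsUpperSet (G : Set (Finset α))) :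
    IsLowerSet (cofam G : Set (Finset α)) := by
  intro t s hst ht
  rw [mem_coe, mem_cofam] at ht ⊢
  obtain ⟨y, hy, rfl⟩ := ht
  refine ⟨univ \ s, h ?_ hy, Finset.sdiff_sdiff_eq_self (subset_univ s)⟩
  intro x hx
  rw [mem_sdiff]
  refine ⟨mem_univ x, fun hxs => ?_⟩
  exact (mem_sdiff.1 (hst hxs)).2 hx

end Complements

section LemmaX

/-- The lost members of `D = cofam U₀`: those all of whose `U`-supersets were removed. -/
def lostSet (U U₀ T : Finset (Finset α)) : Finset (Finset α) :=
  (cofam U₀).filter fun z => ∀ g ∈ U, z ⊆ g → g ∈ U₀ \ T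

/-- The up-closure of the lost set. -/
def lostUp (U U₀ T : Finset (Finset α)) : Finset (Finset α) :=
  univ.filter fun a => ∃ z ∈ lostSet U U₀ T, z ⊆ a

variable {U U₀ T : Finset (Finset α)}

/-- Membership in `lostSet`. -/
theorem mem_lostSet {z : Finset α} :
    z ∈ lostSet U U₀ T ↔ z ∈ cofam U₀ ∧ ∀ g ∈ U, z ⊆ g → g ∈ U₀ \ T := by
  simp only [lostSet, mem_filter]

/-- `Lost ⊆ D`. -/
theorem lostSet_subset : lostSet U U₀ T ⊆ cofam U₀ := filter_subset _ _

/-- Membership in `lostUp`. -/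
theorem mem_lostUp {a : Finset α} : a ∈ lostUp U U₀ T ↔ ∃ z ∈ lostSet U U₀ T, z ⊆ a := by
  simp only [lostUp, mem_filter, mem_univ, true_and]

/-- `lostUp` is an upper set. -/
theorem isUpperSet_lostUp : IsUpperSet (lostUp U U₀ T : Set (Finset α)) := by
  intro a b hab ha
  rw [mem_coe, mem_lostUp] at ha ⊢
  obtain ⟨z, hz, hza⟩ := ha
  exact ⟨z, hz, hza.trans hab⟩

/-- `D ∩ ↑Lost = Lost`. -/
theorem cofam_inter_lostUp : cofam U₀ ∩ lostUp U U₀ T = lostSet U U₀ T := by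
  ext z
  rw [mem_inter, mem_lostUp, mem_lostSet]
  constructor
  · rintro ⟨hz, z', hz', hz'z⟩
    refine ⟨hz, fun g hg hzg => ?_⟩
    exact (mem_lostSet.1 hz').2 g hg (hz'z.trans hzg)
  · intro hz
    exact ⟨hz.1, z, mem_lostSet.2 hz, Subset.refl z⟩

/-- `U₀ ∩ ↑Lost ⊆ R`. -/
theorem inter_lostUp_subset (hU₀U : U₀ ⊆ U) : U₀ ∩ lostUp U U₀ T ⊆ U₀ \ T := by
  intro g hg
  obtain ⟨hg₀, hgA⟩ := mem_inter.1 hg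
  obtain ⟨z, hz, hzg⟩ := mem_lostUp.1 hgA
  exact (mem_lostSet.1 hz).2 g (hU₀U hg₀) hzg

/-- Complementation maps `U₀ ∩ ↑Lost` onto `D ∩ (univ − ↑Lost)`. -/
theorem card_inter_lostUp_eq :
    (U₀ ∩ lostUp U U₀ T).card = (cofam U₀ ∩ cofam (lostUp U U₀ T)).card := by
  rw [← card_image_of_injective (U₀ ∩ lostUp U U₀ T) univ_sdiff_injective]
  congr 1
  ext w
  rw [mem_image, mem_inter, mem_cofam, mem_cofam]
  constructor
  · rintro ⟨y, hy, rfl⟩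
    exact ⟨⟨y, (mem_inter.1 hy).1, rfl⟩, ⟨y, (mem_inter.1 hy).2, rfl⟩⟩
  · rintro ⟨⟨y, hy, rfl⟩, ⟨a, ha, hay⟩⟩
    have : a = y := univ_sdiff_injective hay
    rw [this] at ha
    exact ⟨y, mem_inter.2 ⟨hy, ha⟩, rfl⟩

omit [Fintype α] in
/-- Removing a set of elements one by one stays inside a family closed under each removal. -/
theorem sdiff_mem_of_forall_erase_mem (W : Finset α)
    (hW : ∀ e ∈ W, ∀ y ∈ U₀, y.erase e ∈ U₀) : ∀ y ∈ U₀, y \ W ∈ U₀ := by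
  induction W using Finset.induction_on with
  | empty => intro y hy; simpa using hy
  | insert a W haW ih =>
    intro y hy
    rw [sdiff_insert]
    exact hW a (mem_insert_self a W) _ (ih (fun e he => hW e (mem_insert_of_mem he)) y hy)

/-- **The common coordinate.** A minimal lost `z` and a `y₁ ∈ U ∖ U₀` give an `e ∈ z` on which
`U₀` depends: some `y ∈ U₀` has `y.erase e ∉ U₀`. -/
theorem exists_depends (hU : IsUpperSet (U : Set (Finset α))) {z y₁ : Finset α}
    (hz : z ∈ lostSet U U₀ T) (hy₁ : y₁ ∈ U) (hy₁' : y₁ ∉ U₀) :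
    ∃ e ∈ z, ∃ y ∈ U₀, y.erase e ∉ U₀ := by
  by_contra hcon
  push Not at hcon
  have hzy : z ∪ y₁ ∈ U₀ \ T := by
    refine (mem_lostSet.1 hz).2 _ (hU subset_union_right hy₁) subset_union_left
  have hall : ∀ e ∈ z \ y₁, ∀ y ∈ U₀, y.erase e ∈ U₀ :=
    fun e he y hy => hcon e (mem_sdiff.1 he).1 y hy
  have h := sdiff_mem_of_forall_erase_mem (z \ y₁) hall (z ∪ y₁) (mem_sdiff.1 hzy).1
  have hid : (z ∪ y₁) \ (z \ y₁) = y₁ := by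
    ext x
    simp only [mem_sdiff, mem_union]
    tauto
  rw [hid] at h
  exact hy₁' h

/-- A witness that `D = cofam U₀` depends on `e`, in `memberSubfamily` terms. -/
theorem card_memberSubfamily_cofam_lt (hU₀ : IsUpperSet (U₀ : Set (Finset α))) {e : α}
    {y : Finset α} (hy : y ∈ U₀) (hye : y.erase e ∉ U₀) :
    ((cofam U₀).memberSubfamily e).card < ((cofam U₀).nonMemberSubfamily e).card := by
  have hey : e ∈ y := by
    by_contra h
    rw [erase_eq_of_notMem h] at hye
    exact hye hy
  have hsub := (isLowerSet_cofam hU₀).memberSubfamily_subset_nonMemberSubfamily (a := e)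
  apply card_lt_card
  refine ssubset_of_subset_of_ne hsub fun heq => ?_
  have hin : univ \ y ∈ (cofam U₀).nonMemberSubfamily e :=
    mem_nonMemberSubfamily.2 ⟨mem_cofam.2 ⟨y, hy, rfl⟩, fun h => (mem_sdiff.1 h).2 hey⟩
  rw [← heq, mem_memberSubfamily] at hin
  obtain ⟨hin, -⟩ := hin
  rw [mem_cofam] at hin
  obtain ⟨y', hy', hy'e⟩ := hin
  have hid : insert e (univ \ y) = univ \ y.erase e := by
    ext x
    simp only [mem_insert, mem_sdiff, mem_univ, true_and, mem_erase, not_and]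
    constructor
    · rintro (rfl | hx)
      · exact fun h => absurd rfl h
      · exact fun _ => hx
    · intro h
      by_cases hxe : x = e
      · exact Or.inl hxe
      · exact Or.inr (h hxe)
  rw [hid] at hy'e
  have hyy := univ_sdiff_injective hy'e
  rw [hyy] at hy'
  exact hye hy'

/-- A witness that `↑Lost` depends on `e ∈ z` for a lost `z` of minimal cardinality. -/
theorem card_nonMemberSubfamily_lostUp_lt {z : Finset α} (hz : z ∈ lostSet U U₀ T)
    (hmin : ∀ z' ∈ lostSet U U₀ T, z.card ≤ z'.card) {e : α} (he : e ∈ z) :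
    ((lostUp U U₀ T).nonMemberSubfamily e).card < ((lostUp U U₀ T).memberSubfamily e).card := by
  have hsub := IsUpperSet.nonMemberSubfamily_subset_memberSubfamily (e := e)
    (isUpperSet_lostUp (U := U) (U₀ := U₀) (T := T))
  apply card_lt_card
  refine ssubset_of_subset_of_ne hsub fun heq => ?_
  have hin : z.erase e ∈ (lostUp U U₀ T).memberSubfamily e := by
    refine mem_memberSubfamily.2 ⟨?_, notMem_erase e z⟩
    rw [insert_erase he]
    exact mem_lostUp.2 ⟨z, hz, Subset.refl z⟩
  rw [← heq, mem_nonMemberSubfamily, mem_lostUp] at hin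
  obtain ⟨⟨z', hz', hz'z⟩, -⟩ := hin
  have h1 := hmin z' hz'
  have h2 := card_le_card hz'z
  have h3 := card_erase_lt_of_mem he
  omega

/-- **LEMMA X (lost form).** `|Lost| + 1 ≤ |U₀ ∖ T|`. -/
theorem lemmaX_lost (hU : IsUpperSet (U : Set (Finset α))) (hU₀ : IsUpperSet (U₀ : Set (Finset α)))
    (hU₀U : U₀ ⊆ U) (hU₁ : (U \ U₀).Nonempty) (hT : T ⊆ U₀) (hTne : T ≠ U₀) :
    (lostSet U U₀ T).card + 1 ≤ (U₀ \ T).card := by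
  have hR : (U₀ \ T).Nonempty := by
    rw [sdiff_nonempty]
    exact fun h => hTne (Subset.antisymm hT h)
  by_cases hLost : (lostSet U U₀ T).Nonempty
  · obtain ⟨z, hz, hmin⟩ := Finset.exists_min_image (lostSet U U₀ T) card hLost
    obtain ⟨y₁, hy₁⟩ := hU₁
    obtain ⟨hy₁U, hy₁U₀⟩ := mem_sdiff.1 hy₁
    obtain ⟨e, hez, y, hy, hye⟩ := exists_depends hU hz hy₁U hy₁U₀
    have hDe := card_memberSubfamily_cofam_lt hU₀ hy hye
    have hAe := card_nonMemberSubfamily_lostUp_lt hz hmin hez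
    have hstrict := card_inter_mul_lt_of_depends (isLowerSet_cofam hU₀) isUpperSet_lostUp e hDe hAe
    have hHK := (isLowerSet_cofam hU₀).le_card_inter_finset
      (isLowerSet_cofam (isUpperSet_lostUp (U := U) (U₀ := U₀) (T := T)))
    rw [card_cofam (lostUp U U₀ T), ← card_inter_lostUp_eq] at hHK
    rw [cofam_inter_lostUp] at hstrict
    have hsub := card_le_card (inter_lostUp_subset (T := T) hU₀U)
    have hpos : 0 < 2 ^ Fintype.card α := pow_pos (by norm_num) _
    have hlt : 2 ^ Fintype.card α * (lostSet U U₀ T).card <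
        2 ^ Fintype.card α * (U₀ \ T).card := by
      calc 2 ^ Fintype.card α * (lostSet U U₀ T).card
          < (cofam U₀).card * (lostUp U U₀ T).card := hstrict
        _ ≤ 2 ^ Fintype.card α * (U₀ ∩ lostUp U U₀ T).card := hHK
        _ ≤ 2 ^ Fintype.card α * (U₀ \ T).card := Nat.mul_le_mul_left _ hsub
    have := Nat.lt_of_mul_lt_mul_left hlt
    omega
  · rw [not_nonempty_iff_eq_empty] at hLost
    rw [hLost, card_empty]
    exact hR.card_pos

/-- The members of `D` below some member of `(U ∖ U₀) ∪ T`: the complement of `Lost` in `D`. -/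
theorem filter_below_eq_sdiff_lost (hU₀U : U₀ ⊆ U) (hT : T ⊆ U₀) :
    (cofam U₀).filter (fun z => ∃ g ∈ (U \ U₀) ∪ T, z ⊆ g) = cofam U₀ \ lostSet U U₀ T := by
  ext z
  rw [mem_filter, mem_sdiff, mem_lostSet]
  constructor
  · rintro ⟨hz, g, hg, hzg⟩
    refine ⟨hz, fun h => ?_⟩
    have hgR := h.2 g ?_ hzg
    · rcases mem_union.1 hg with hg' | hg'
      · exact (mem_sdiff.1 hg').2 (mem_sdiff.1 hgR).1
      · exact (mem_sdiff.1 hgR).2 hg'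
    · rcases mem_union.1 hg with hg' | hg'
      · exact (mem_sdiff.1 hg').1
      · exact hU₀U (hT hg')
  · rintro ⟨hz, h⟩
    refine ⟨hz, ?_⟩
    by_contra hcon
    push Not at hcon
    refine h ⟨hz, fun g hg hzg => ?_⟩
    rw [mem_sdiff]
    by_contra hg'
    have hgU₀ : g ∈ U₀ := by
      by_contra hgU₀
      exact hcon g (mem_union_left _ (mem_sdiff.2 ⟨hg, hgU₀⟩)) hzg
    exact hcon g (mem_union_right _ (by tauto)) hzg

/-- **LEMMA X.** The members of `D = {univ ∖ y : y ∈ U₀}` lying below some member of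
`(U ∖ U₀) ∪ T` number at least `|T| + 1`. -/
theorem lemmaX (hU : IsUpperSet (U : Set (Finset α))) (hU₀ : IsUpperSet (U₀ : Set (Finset α)))
    (hU₀U : U₀ ⊆ U) (hU₁ : (U \ U₀).Nonempty) (hT : T ⊆ U₀) (hTne : T ≠ U₀) :
    T.card + 1 ≤ ((cofam U₀).filter fun z => ∃ g ∈ (U \ U₀) ∪ T, z ⊆ g).card := by
  rw [filter_below_eq_sdiff_lost hU₀U hT, card_sdiff_of_subset (lostSet_subset (U := U) (T := T)),
    card_cofam]
  have h1 := lemmaX_lost hU hU₀ hU₀U hU₁ hT hTne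
  have h2 := card_sdiff_add_card_eq_card hT
  have h3 := card_le_card (lostSet_subset (U := U) (U₀ := U₀) (T := T))
  rw [card_cofam] at h3
  omega

end LemmaX

end PercRepro.MSTight
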